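import Summits.CriticalPhenomena.PercolationContinuityZ3.Theorems.PercAnnulusCrossingIICInsideFarQuasiIndependenceUpper
import Summits.CriticalPhenomena.PercolationContinuityZ3.Theorems.PercAnnulusCrossingIICLocalConnectionFar
import HarnessLib

/-!
# A near site joins Kesten's IIC at most at the one-arm price, whatever far sites it contains (lane RSW3, p1 gen 21)

builds on p205010 (kernel theorem, internal audit signed; external expert review pending) — NOT used in this file
(only `p_c(ℤ^d) > 0`).

RSW3 lane (LANE 3 `prim-rsw3`), seat `prim-rsw3-p1` (gen 21).  Helper file (`--supports stmt-CriticalPhenomena-4575`);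
no definitions, no sorries.  Memo `run/shared/lean/prim/rsw3/P1-QM.md` §34.5 (U), §34.8.

The UPPER companion of `…IICNearSiteGivenFar`: split `{0 ↔ v}` into the localised event `D = {0 ↔ v in Λ(2‖v‖)}` (saturated in the cluster of
the origin inside `Λ(2‖v‖)`, of measure `≤ ν(0 ↔ v) ≤ Cπ(‖v‖)`) — priced jointly with the far configuration by the upper quasi-independence
`ν(D ∩ {S ⊆ C(0)}) ≤ C·ν(D)·ν(S ⊆ C(0))` (`…IICInsideFarQuasiIndependenceUpper`, inner scale `m = 2‖v‖ + 1`, `a − 1 = sm`) — and the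
non-local part `{0 ↔ v} ∖ D`, priced by the joint splitting estimate `≤ C·π(2‖v‖)·ν(S ⊆ C(0))` (`…IICLocalConnectionFar`, `a − 1 = 2‖v‖`):

* **`exists_iicMeasure_real_openConn_inter_biInter_le_criticalProbI`** — at `p_c(ℤ^d)`, `d ≥ 2`, under (A2)□(s,L) + `CU⁺_l` + UAD: there are
  `n₀ ≥ 1` and `C > 0` such that for every finite measure `ν` with Kesten's IIC limit property, every `v` with `‖v‖_∞ ≥ n₀` and every finite `S`
  with `S ∩ Λ(4ls·‖v‖_∞) = ∅`: **`ν({0 ↔ v} ∩ {S ⊆ C(0)}) ≤ C·π_{p_c}(‖v‖)·ν(S ⊆ C(0))`**.  With `…IICNearSiteGivenFar`: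
  `ν({0 ↔ v} ∩ {S ⊆ C(0)}) ≍ π(‖v‖)·ν(S ⊆ C(0))` — the step (U)+(L) of the spanning-tree formula, uniformly in the far configuration.
References: H. Kesten, Probab. Theory Relat. Fields 73 (1986) §2, Thm. (8); D. Basu, A. Sapozhnikov, ECP 22 (2017) Thm. 1.1.
-/

noncomputable section

namespace Summit.CriticalPhenomena.PercolationContinuityZ3.Theorems.Crossing

open MeasureTheory Filter Topology Literature.Probability.Percolation Literature.Probability.LatticeModels
open Literature.Probability.Percolation.DCT16
open Summit.CriticalPhenomena.PercolationContinuityZ3.Theorems.SurfaceTension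

variable {d : ℕ}

open Classical in
/-- **A NEAR SITE JOINS KESTEN'S IIC AT MOST AT THE ONE-ARM PRICE, WHATEVER FAR SITES IT CONTAINS** (`p_c(ℤ^d)`, `d ≥ 2`; (A2)□ at aspect
`(s,L)`, `2 ≤ s ≤ L`, `ϰ > 0`; `CU⁺_l(c_U)`, `l ≥ 2`, `c_U > 0`; UAD): there are `n₀ ≥ 1`, `C > 0` such that for every finite measure `ν` with
Kesten's IIC limit property, every site `v` with `‖v‖_∞ ≥ n₀` and every finite `S` with `z ∉ Λ(4ls‖v‖_∞)` on `S`: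
**`ν({0 ↔ v} ∩ ⋂_{z∈S}{0 ↔ z}) ≤ C·π_{p_c}(‖v‖)·ν(⋂_{z∈S}{0 ↔ z})`**. [cite: Kesten1986, §2, Thm. (8)] [cite: BasuSapozhnikov2017ECP, Thm. 1.1] -/
theorem exists_iicMeasure_real_openConn_inter_biInter_le_criticalProbI (hd : 2 ≤ d) {s L : ℕ} (hs : 2 ≤ s) (hsL : s ≤ L)
    {ϰ : ℝ} (hϰ : 0 < ϰ) (hA2 : SetToSetQuasiMultAspectAt d (criticalProbI d) s L ϰ) {l : ℕ} (hl : 2 ≤ l) {cU : ℝ} (hcU : 0 < cU)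
    (hCU : ∀ a : ℕ, 1 ≤ a → ∀ E : Set (BondConfig (Site d)), IsUpperSet E → MeasurableSet E →
      cU * (bondPercolation (zdGraph d) (criticalProbI d)).real E ≤ (bondPercolation (zdGraph d) (criticalProbI d)).real (E ∩
        {ω : BondConfig (Site d) | ∀ t ∈ innerBoundary (zdGraph d) (box d a), ∀ s ∈ innerBoundary (zdGraph d) (box d (l * a)),
          ∀ t' ∈ innerBoundary (zdGraph d) (box d a), ∀ s' ∈ innerBoundary (zdGraph d) (box d (l * a)),
          ω ∈ openConnIn (↑((box d (l * a) \ box d a) ∪ innerBoundary (zdGraph d) (box d a)) : Set (Site d)) t s →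
          ω ∈ openConnIn (↑((box d (l * a) \ box d a) ∪ innerBoundary (zdGraph d) (box d a)) : Set (Site d)) t' s' →
          ω ∈ openConnIn (↑((box d (l * a) \ box d a) ∪ innerBoundary (zdGraph d) (box d a)) : Set (Site d)) s s'}))
    (hUAD : ∀ ε : ℝ, 0 < ε → ∃ K₀ : ℕ, ∀ m : ℕ, 1 ≤ m → ∀ N : ℕ, K₀ * m ≤ N →
      (bondPercolation (zdGraph d) (criticalProbI d)).real (boxCrossing d m N) ≤ ε) :
    ∃ (n₀ : ℕ) (C : ℝ), 1 ≤ n₀ ∧ 0 < C ∧ ∀ (ν : Measure (BondConfig (Site d))) [IsFiniteMeasure ν],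
      (∀ (F : Finset (Sym2 (Site d))) (E : Set (BondConfig (Site d))), MeasurableSet E → DeterminedBy E ↑F →
        Tendsto (fun n : ℕ => (bondPercolation (zdGraph d) (criticalProbI d)).real (E ∩ siteToBoundary d n) /
          oneArmProb d (criticalProbI d) n) atTop (𝓝 (ν.real E))) →
      ∀ (v : Site d) (S : Finset (Site d)), n₀ ≤ Site.supNorm v → (∀ z ∈ S, z ∉ box d (4 * l * s * Site.supNorm v)) →
        ν.real ((openConn (0 : Site d) v : Set (BondConfig (Site d))) ∩ ⋂ z ∈ S, (openConn (0 : Site d) z : Set (BondConfig (Site d)))) ≤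
          C * oneArmProb d (criticalProbI d) (Site.supNorm v) * ν.real (⋂ z ∈ S, (openConn (0 : Site d) z : Set (BondConfig (Site d)))) := by
  have hd1 : 1 ≤ d := le_trans (by norm_num) hd
  have hp : 0 < ((criticalProbI d : unitInterval) : ℝ) := by
    rw [coe_criticalProbI]; exact criticalProb_zd_pos d hd1
  have hπ : ∀ m : ℕ, 0 < oneArmProb d (criticalProbI d) m := fun m => oneArmProb_pos hd1 _ hp m
  obtain ⟨CK, hCK, hK⟩ := exists_iicMeasure_real_inter_biInter_openConn_le_mul_criticalProbI hd hs hsL hϰ hA2 hl hcU hCU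
  obtain ⟨CL, hCL, hL⟩ := exists_iicMeasure_real_openConn_diff_inter_biInter_le_criticalProbI hd hs hsL hϰ hA2 hl hcU hCU
  obtain ⟨n₂, c₂, C₂, hn₂, hc₂, hC₂, h2⟩ := exists_iicMeasure_real_openConn_two_sided_criticalProbI hd hs hsL hϰ hA2 hl hcU hCU hUAD
  refine ⟨n₂, CK * C₂ + CL, hn₂, by positivity, fun ν _ hν v S hv hS => ?_⟩
  have hn1 : 1 ≤ Site.supNorm v := le_trans hn₂ hv
  have hs1 : 1 ≤ s := by omega
  -- scales: `D` lives in `Λ(2n)`, inner scale `m = 2n+1`, `a − 1 = s(2n+1)`; the splitting at `a' − 1 = 2n`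
  obtain ⟨n, hn⟩ : ∃ n, n = Site.supNorm v := ⟨_, rfl⟩
  rw [← hn] at hv hn1 hS ⊢
  have hfarK : ∀ z ∈ S, z ∉ box d (l * (s * (2 * n + 1) + 1) - 1) := by
    intro z hz h
    refine hS z hz (box_mono d ?_ h)
    have h1 : l * (s * (2 * n + 1) + 1) ≤ 4 * l * s * n := by
      have : s * (2 * n + 1) + 1 ≤ 4 * s * n := by nlinarith
      calc l * (s * (2 * n + 1) + 1) ≤ l * (4 * s * n) := Nat.mul_le_mul_left l this
        _ = 4 * l * s * n := by ring
    omega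
  have hfarL : ∀ z ∈ S, z ∉ box d (l * (2 * n + 1) - 1) := by
    intro z hz h
    refine hS z hz (box_mono d ?_ h)
    have h1 : l * (2 * n + 1) ≤ 4 * l * s * n := by
      have : 2 * n + 1 ≤ 4 * s * n := by nlinarith
      calc l * (2 * n + 1) ≤ l * (4 * s * n) := Nat.mul_le_mul_left l this
        _ = 4 * l * s * n := by ring
    omega
  -- the localised event
  have hDdet : DeterminedBy (openConnIn (↑(box d (2 * n)) : Set (Site d)) (0 : Site d) v : Set (BondConfig (Site d)))
      (↑((box d (s * (2 * n + 1) + 1 - 1)).sym2) : Set (Sym2 (Site d))) := by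
    rw [Nat.add_sub_cancel]
    exact (determinedBy_openConnIn (↑(box d (2 * n))) 0 v (K := ↑(box d (2 * n)).sym2) (by rw [Finset.coe_sym2])).mono
      (Finset.coe_subset.2 (Finset.sym2_mono (box_mono d (by nlinarith))))
  have hsat : ∀ ω ω' : BondConfig (Site d), DCT16.clusterSet (box d (2 * n + 1 - 1)) ω = DCT16.clusterSet (box d (2 * n + 1 - 1)) ω' →
      (ω ∈ (openConnIn (↑(box d (2 * n)) : Set (Site d)) (0 : Site d) v : Set (BondConfig (Site d))) ↔
        ω' ∈ (openConnIn (↑(box d (2 * n)) : Set (Site d)) (0 : Site d) v : Set (BondConfig (Site d)))) := by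
    intro ω ω' h
    rw [Nat.add_sub_cancel] at h
    have h' := congrArg (fun A : Set (Site d) => v ∈ A) h
    simpa [DCT16.clusterSet] using h'
  have hK' := hK ν hν (2 * n + 1) (s * (2 * n + 1) + 1) (by omega) (by rw [Nat.add_sub_cancel]) (by rw [Nat.add_sub_cancel]; nlinarith)
    _ (measurableSet_openConnIn _ 0 v) hDdet hsat S hfarK
  have hL' := hL ν hν v (2 * n + 1) (by omega) (by rw [Nat.add_sub_cancel, hn]) S hfarL
  rw [Nat.add_sub_cancel] at hL'
  have ht := (h2 ν hν n v hv (by rw [hn]; exact self_mem_sphere v)).2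
  -- `ν(D) ≤ ν(0 ↔ v) ≤ C₂ π(n)`
  have hDle : ν.real (openConnIn (↑(box d (2 * n)) : Set (Site d)) (0 : Site d) v) ≤ C₂ * oneArmProb d (criticalProbI d) n := by
    refine le_trans (measureReal_mono ?_ (measure_ne_top _ _)) ht
    rw [Literature.Barriers.CriticalPhenomena.openConn_zero_eq_iUnion_openConnIn v]
    exact Set.subset_iUnion (fun m : ℕ => (openConnIn (↑(box d m) : Set (Site d)) (0 : Site d) v : Set (BondConfig (Site d)))) _
  -- the split `{0 ↔ v} ⊆ D ∪ ({0 ↔ v} ∖ D)`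
  have hνS : 0 ≤ ν.real (⋂ z ∈ S, (openConn (0 : Site d) z : Set (BondConfig (Site d)))) := measureReal_nonneg
  have hπn := hπ n
  have hπ2n : oneArmProb d (criticalProbI d) (2 * n) ≤ oneArmProb d (criticalProbI d) n := real_siteToBoundary_antitone _ (by omega)
  have hsub : (openConn (0 : Site d) v : Set (BondConfig (Site d))) ∩ (⋂ z ∈ S, (openConn (0 : Site d) z : Set (BondConfig (Site d)))) ⊆
      ((openConnIn (↑(box d (2 * n)) : Set (Site d)) (0 : Site d) v : Set (BondConfig (Site d))) ∩
          ⋂ z ∈ S, (openConn (0 : Site d) z : Set (BondConfig (Site d)))) ∪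
        ((((openConn (0 : Site d) v : Set (BondConfig (Site d))) \ openConnIn (↑(box d (2 * n)) : Set (Site d)) 0 v) ∩
          ⋂ z ∈ S, (openConn (0 : Site d) z : Set (BondConfig (Site d))))) := by
    intro ω hω
    rcases Classical.em (ω ∈ (openConnIn (↑(box d (2 * n)) : Set (Site d)) (0 : Site d) v : Set (BondConfig (Site d)))) with hD | hD
    · exact Or.inl ⟨hD, hω.2⟩
    · exact Or.inr ⟨⟨hω.1, hD⟩, hω.2⟩
  have h1 := (measureReal_mono hsub (measure_ne_top ν _)).trans (measureReal_union_le (μ := ν)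
    ((openConnIn (↑(box d (2 * n)) : Set (Site d)) (0 : Site d) v : Set (BondConfig (Site d))) ∩
      ⋂ z ∈ S, (openConn (0 : Site d) z : Set (BondConfig (Site d))))
    ((((openConn (0 : Site d) v : Set (BondConfig (Site d))) \ openConnIn (↑(box d (2 * n)) : Set (Site d)) 0 v) ∩
      ⋂ z ∈ S, (openConn (0 : Site d) z : Set (BondConfig (Site d))))))
  have h2 : CK * ν.real (openConnIn (↑(box d (2 * n)) : Set (Site d)) (0 : Site d) v) *
      ν.real (⋂ z ∈ S, (openConn (0 : Site d) z : Set (BondConfig (Site d)))) ≤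
      CK * (C₂ * oneArmProb d (criticalProbI d) n) * ν.real (⋂ z ∈ S, (openConn (0 : Site d) z : Set (BondConfig (Site d)))) :=
    mul_le_mul_of_nonneg_right (mul_le_mul_of_nonneg_left hDle hCK.le) hνS
  have h3 : CL * oneArmProb d (criticalProbI d) (2 * n) * ν.real (⋂ z ∈ S, (openConn (0 : Site d) z : Set (BondConfig (Site d)))) ≤
      CL * oneArmProb d (criticalProbI d) n * ν.real (⋂ z ∈ S, (openConn (0 : Site d) z : Set (BondConfig (Site d)))) :=
    mul_le_mul_of_nonneg_right (mul_le_mul_of_nonneg_left hπ2n hCL.le) hνS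
  have h4 : (CK * C₂ + CL) * oneArmProb d (criticalProbI d) n * ν.real (⋂ z ∈ S, (openConn (0 : Site d) z : Set (BondConfig (Site d)))) =
      CK * (C₂ * oneArmProb d (criticalProbI d) n) * ν.real (⋂ z ∈ S, (openConn (0 : Site d) z : Set (BondConfig (Site d)))) +
        CL * oneArmProb d (criticalProbI d) n * ν.real (⋂ z ∈ S, (openConn (0 : Site d) z : Set (BondConfig (Site d)))) := by ring
  rw [h4]
  linarith [h1, hK', hL', h2, h3]

end Summit.CriticalPhenomena.PercolationContinuityZ3.Theorems.Crossing

end
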